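import Literature.NumberTheory.Automorphic.ShimuraCurveRibetTakahashiNumeratorProofs
import HarnessLib

/-!
# Pasten 2024, Thm. 6.1 (b) (denominator of `γ_{D,M,E}`): the printed telescoping of §6.9,
# performed in the tree

Topic `NumberTheory/Automorphic`; a proofs-only companion (theorems only: no definition, no named
fact, nothing restated; D-0026) of `ShimuraCurveRibetTakahashi.lean` for its named fact
`Literature.NumberTheory.Automorphic.PastenShimura2024_thm_6_1_b` (H. Pasten, *Shimura curves and
the abc conjecture*, J. Number Theory 254 (2024) = arXiv:1705.09251, Thm. 6.1 (b) p. 20: an absolute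
`κ ≥ 1` supported on primes `≤ 163` such that, for `E` semistable and `M` not prime (b.1), or `E`
Frey–Hellegouarch and `M` divisible by two odd primes (b.2), the denominator of `γ_{D,M,E}` divides
`κ^{ω(D)}`). It is the part-(b) twin of the sibling `ShimuraCurveRibetTakahashiNumeratorProofs.lean`
(numerator statement `PastenShimura2024_thm_6_1`), whose arithmetic of admissible factorisations
(`IsAdmissibleFactorization.erase_two_primes`, `dvd_and_not_sq_dvd`) and existence of class-minimal
data (`ShimuraParametrizationData.exists_isMinimalFor_of_nonempty`) it reuses.

The source, §6.9 p. 25 (held arXiv text, read): *"By Proposition 6.13 and Lemma 6.8 we have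
(EqSequentially) `δ_{d,prm}/δ_{dpr,m} = u_{d,p,r,m}/(i_p(d,prm)² j_r(dpr,m)²) · c_p(E) c_r(E)` …
Repeated applications of this observation (to sequentially remove prime factors from `D`) … The
result of item (a) regarding the denominator of `γ_{D,M,E}` follows in a similar fashion. Here one
also uses Lemma 6.14 on the factors `i_p(d,prm)²` occurring in the various applications of
(EqSequentially) … Finally, the result of item (b) is also obtained by a similar argument. Here,
the cokernel factors `j_r(dpr,m)²` are controlled by Theorem 6.17 instead of Lemma 6.18, giving the
claimed stronger estimates in this case."* Lemma 6.14 (p. 23): for `N = DM` squarefree away from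
`S` and `p ∥ M`, `i_p(D,M)` divides an integer `κ_S` depending only on `S` and supported on primes
`≤ 163`; Thm. 6.17 (p. 24): under (i) = (b.1) or (ii) = (b.2), `j_p(D,M) ∣ κ` for `p ∣ D`, `κ ≥ 1`
absolute and supported on primes `≤ 163`; Lemma 6.8 (p. 22): `c_p(A)/c_p(B)` has height `≤ 163`
for `ℚ`-isogenous `A, B` multiplicative at `p`; `c_p(E) = v_p(Δ_E)` (§6.4 p. 22).

What this file proves (sorry-free, no new named fact, no statement of the tree changed):

* `rtClass_mul` — the classes (b.1)/(b.2) relative to `M` pass to the larger levels `prM` of the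
  telescoping product (`M` not prime ⇒ `prM` not prime; odd primes of `M` divide `prM`);
* `PastenShimura2024_thm_6_1_b_of_eqSequentially` — **Thm. 6.1 (b) from the bounded two-prime
  step, exactly as printed**: the induction on `n = ω(D)/2` of the sibling's
  `PastenShimura2024_thm_6_1_of_eqSequentially`, now multiplying DENOMINATORS: inputs (`hstep`)
  (EqSequentially) with Lemmas 6.8, 6.14 and Thm. 6.17 folded in — for `E` in class (b.1)/(b.2)
  relative to `M`, `δ_{d,prM} · b = a · δ_{D,M} · v_p(Δ_E) v_r(Δ_E)` with `a, b ≥ 1` and `b ∣ κ₀`,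
  one absolute `κ₀ ≥ 1` supported on primes `≤ 163` —, (`h0`) the case `D = 1` (the class-minimal
  degree of Shimura data on an `X : ShimuraCurveData 1 N` divides `δ_{1,N}`, the class-minimal
  classical degree: Pasten's `J₀^1(N) = J₀(N)`, §2 p. 12, rendered twice in the tree; asked only in
  the class, which is what the fact renders at `D = 1` and gives back:
  `deg_dvd_of_PastenShimura2024_thm_6_1_b`), and the tree's existence facts
  `nonempty_shimuraCurveData`, `nonempty_shimuraParametrizationData` (intermediate curves
  `X₀^d(prM)` and their data); output: the fact with `κ = κ₀` (each of the `ω(D)/2` steps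
  contributes a factor `b_k ∣ κ₀` to the denominator, so `b ∣ κ₀^{ω(D)}`);
* `eqSequentially_b_of_prop_6_13_bounded_of_lemma_6_8` — the bounded two-prime step from
  **Prop. 6.13 with Lemma 6.14 and Thm. 6.17** (`h613b`: Ribet–Takahashi's identity
  `δ_{d,prM} · i² j² = δ_{D,M} · c_p(A_{d,prM}) c_r(A_{D,M})` with `i = i_p(d,prM) ∣ κ₁` and
  `j = j_r(D,M) ∣ κ₂` in the class — the tree has no component groups, so `i, j` are existential
  and their bounds travel with them) and **Lemma 6.8** (`h68`, verbatim the sibling's): then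
  `b = i² j² b₁ b₂ ∣ κ₁² κ₂² (163!)²` and `a = a₁ a₂`;
* `PastenShimura2024_thm_6_1_b_of_prop_6_13_bounded_of_lemma_6_8` — the two glued: the fact from
  `h613b`, `h68`, `h0` and the two existence facts, with `κ = κ₁² κ₂² (163!)²` (supported on primes
  `≤ 163`, `primeFactors_le_of_kappa`). So the open content of `PastenShimura2024_thm_6_1_b_holds`
  beyond its own `D = 1` instance is exactly: Prop. 6.13 (= Ribet–Takahashi 1997 Thm. 2) together
  with Lemma 6.14 (Ribet: `Φ_p(J₀^D(M))` is Eisenstein; Lemmas 6.5–6.7: Faltings, Chebotarev) and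
  Thm. 6.17 (Lemmas 6.9–6.12: Darmon–Granville, level-lowering, Wiles, Darmon–Merel), and Lemma 6.8
  (Mazur–Kenku) — none of whose vocabulary (Néron models, component groups, `J₀^D(M)`) exists in
  Mathlib or the tree.

## References

* H. Pasten, *Shimura curves and the abc conjecture*, J. Number Theory 254 (2024) 214–335 =
  arXiv:1705.09251: §2 p. 12, Thm. 6.1 p. 20, §6.4 and Lemma 6.8 p. 22, Prop. 6.13 and Lemma 6.14
  p. 23, Thm. 6.17 p. 24, §6.9 p. 25. [PastenShimura2024]
* K. A. Ribet, S. Takahashi, *Parametrizations of elliptic curves by Shimura curves and by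
  classical modular curves*, PNAS 94 (1997) 11110–11114, Thm. 2. [RibetTakahashi1997]
-/

noncomputable section

open scoped MatrixGroups ModularForm

namespace Literature.NumberTheory.Automorphic

open Literature.NumberTheory.EllipticCurves.ModularForms (ModularParametrizationData IsNewformOf)

/-! ### The classes (b.1)/(b.2) are inherited by the larger levels `p r M` -/

/-- The hypothesis of Thm. 6.1 (b) relative to `M` — (b.1) `E` semistable and `M` not prime, or
(b.2) `E` Frey–Hellegouarch and `M` divisible by two odd primes — implies the same hypothesis
relative to `p r M` (`p, r` primes, `M ≥ 1`): the intermediate levels `N/(p₁r₁⋯p_kr_k) ⊇ M` of the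
telescoping product of §6.9 stay in the class, so that Thm. 6.17 applies at each of them.
[cite: PastenShimura2024, §6.9 p. 25 (proof of Thm. 6.1 (b))] -/
theorem rtClass_mul {W : WeierstrassCurve ℚ} {M p r : ℕ} (hp : p.Prime) (hr : r.Prime)
    (hM : 0 < M)
    (h : (W.IsSemistable ℤ ∧ ¬ M.Prime) ∨
      (IsFreyHellegouarch W ∧ 2 ≤ (M.primeFactors.erase 2).card)) :
    (W.IsSemistable ℤ ∧ ¬ (p * r * M).Prime) ∨
      (IsFreyHellegouarch W ∧ 2 ≤ ((p * r * M).primeFactors.erase 2).card) := by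
  rcases h with ⟨hss, -⟩ | ⟨hFH, hM2⟩
  · refine Or.inl ⟨hss, ?_⟩
    rw [mul_assoc]
    exact Nat.not_prime_mul hp.ne_one
      (Nat.ne_of_gt (lt_of_lt_of_le hr.one_lt (Nat.le_mul_of_pos_right r hM)))
  · refine Or.inr ⟨hFH, hM2.trans (Finset.card_le_card (Finset.erase_subset_erase 2 ?_))⟩
    exact Nat.primeFactors_mono (Dvd.intro_left _ rfl)
      (mul_ne_zero (mul_ne_zero hp.ne_zero hr.ne_zero) hM.ne')

/-! ### Thm. 6.1 (b) from the bounded two-prime step: the telescoping of §6.9 -/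

/-- **Pasten 2024, Thm. 6.1 (b) from (EqSequentially) with Lemma 6.14 and Thm. 6.17 — the printed
proof** (§6.9 p. 25: "the result of item (b) is also obtained by a similar argument. Here, the
cokernel factors `j_r(dpr,m)²` are controlled by Theorem 6.17"). Inputs:

* (`hstep`) **the bounded two-prime step**, in the tree's idiom: for `N = DM` admissible,
  `D = d · pr` with `p ≠ r` primes, `E` rendered as a globally minimal `W` of conductor `N` in
  class (b.1)/(b.2) relative to `M`, a datum `P₁` realising `δ_{d,prM}` and a datum `P₂` realising
  `δ_{D,M}`: `δ_{d,prM} · b = a · δ_{D,M} · v_p(Δ_E) v_r(Δ_E)` for some `a, b ≥ 1` with `b ∣ κ₀`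
  (`κ₀ ≥ 1` absolute, supported on primes `≤ 163`) — i.e. (EqSequentially) with the denominator of
  `u_{d,p,r,m}` bounded by Lemma 6.8, `i_p(d,prM) ∣ κ_S` by Lemma 6.14 (`S = ∅`, resp. `{2}`) and
  `j_r(D,M) ∣ κ` by Thm. 6.17 (at the admissible factorisation `D · M`, in the class);
* (`h0`) **the case `D = 1`** (`J₀^1(N) = J₀(N)`, §2 p. 12): in the class, the class-minimal degree
  of Shimura data on any `X : ShimuraCurveData 1 N` divides `δ_{1,N} = D₁.modularDegree` (both are
  `δ_{1,N}`; this is what the fact renders at `D = 1`, and the fact gives it back: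
  `deg_dvd_of_PastenShimura2024_thm_6_1_b`);
* (`hX`, `hP`) the tree's named facts `nonempty_shimuraCurveData` and
  `nonempty_shimuraParametrizationData`.

Proof: induction on `n = ω(D)/2` for fixed `N, W, D₁`, as in the sibling's
`PastenShimura2024_thm_6_1_of_eqSequentially`; the class hypothesis passes to the intermediate
level `prM` by `rtClass_mul`; denominators multiply, `b = b₁ b₂ ∣ κ₀^{ω(d)} · κ₀ ∣ κ₀^{ω(D)}`.
[cite: PastenShimura2024, Thm. 6.1 (b) p. 20 and its proof §6.9 p. 25, with Lemma 6.14 p. 23 and Thm. 6.17 p. 24] -/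
theorem PastenShimura2024_thm_6_1_b_of_eqSequentially
    (hX : nonempty_shimuraCurveData) (hP : nonempty_shimuraParametrizationData)
    {κ₀ : ℕ} (hκ₀ : 1 ≤ κ₀) (hκ₀' : ∀ p ∈ κ₀.primeFactors, p ≤ 163)
    (h0 : ∀ {N : ℕ} [NeZero N] (X : ShimuraCurveData 1 N) (W : WeierstrassCurve ℚ) [W.IsElliptic]
      [W.IsGloballyMinimal], W.conductorNorm ℤ = N →
      (W.IsSemistable ℤ ∧ ¬ N.Prime) ∨
        (IsFreyHellegouarch W ∧ 2 ≤ (N.primeFactors.erase 2).card) →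
      ∀ (W₁ : WeierstrassCurve ℚ) [W₁.IsElliptic] (D₁ : ModularParametrizationData W₁ N),
        IsNewformOf W D₁.f →
        (∀ (W₂ : WeierstrassCurve ℚ) [W₂.IsElliptic] (D₂ : ModularParametrizationData W₂ N),
            D₂.f = D₁.f → D₁.modularDegree ≤ D₂.modularDegree) →
      ∀ (W' : WeierstrassCurve ℚ) [W'.IsElliptic] (P : ShimuraParametrizationData X W'),
        P.IsMinimalFor W → P.deg ∣ D₁.modularDegree)
    (hstep : ∀ {N D M d p r : ℕ}, p.Prime → r.Prime → p ≠ r → D = d * (p * r) →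
      IsAdmissibleFactorization N D M →
      ∀ (X₁ : ShimuraCurveData d (p * r * M)) (X₂ : ShimuraCurveData D M)
        (W : WeierstrassCurve ℚ) [W.IsElliptic] [W.IsGloballyMinimal], W.conductorNorm ℤ = N →
        (W.IsSemistable ℤ ∧ ¬ M.Prime) ∨
          (IsFreyHellegouarch W ∧ 2 ≤ (M.primeFactors.erase 2).card) →
      ∀ (W₁' : WeierstrassCurve ℚ) [W₁'.IsElliptic] (P₁ : ShimuraParametrizationData X₁ W₁'),
        P₁.IsMinimalFor W →
      ∀ (W₂' : WeierstrassCurve ℚ) [W₂'.IsElliptic] (P₂ : ShimuraParametrizationData X₂ W₂'),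
        P₂.IsMinimalFor W →
        ∃ a b : ℕ, 0 < a ∧ 0 < b ∧ b ∣ κ₀ ∧
          P₁.deg * b = a * P₂.deg *
            ((W.minimalDiscriminantNorm ℤ).factorization p *
              (W.minimalDiscriminantNorm ℤ).factorization r)) :
    PastenShimura2024_thm_6_1_b := by
  refine ⟨κ₀, hκ₀, hκ₀', ?_⟩
  intro N D M _ hadm X W _ _ hWN hcl W₁ _ D₁ hf hmin W' _ P hPmin
  -- the printed induction on `n = ω(D)/2`, for fixed `N`, `W` (= `E`) and `δ_{1,N}` (= `D₁`)
  obtain ⟨n, hn⟩ := hadm.even_card_primeFactors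
  induction n generalizing D M W' with
  | zero =>
    -- `D = 1`, `M = N`: `deg P ∣ δ_{1,N}` (`h0`), take `b = 1`
    have hD : D = 1 := by
      have h1 := Nat.primeFactors_eq_empty.mp (Finset.card_eq_zero.mp hn)
      exact h1.resolve_left hadm.squarefree.ne_zero
    subst hD
    obtain rfl : M = N := by simpa using hadm.mul_eq
    obtain ⟨a, ha⟩ := h0 X W hWN hcl W₁ D₁ hf hmin W' P hPmin
    refine ⟨a, 1, Nat.pos_of_ne_zero ?_, Nat.one_pos, one_dvd _, ?_⟩
    · rintro rfl
      exact D₁.deg_pos.ne' (by simpa [ModularParametrizationData.modularDegree] using ha)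
    · simp [ha, mul_comm]
  | succ n ih =>
    -- two primes `p ≠ r` of `D`, `d = D/(pr)`
    obtain ⟨p, hp⟩ : D.primeFactors.Nonempty := Finset.card_pos.mp (by omega)
    obtain ⟨r, hr⟩ : (D.primeFactors.erase p).Nonempty :=
      Finset.card_pos.mp (by rw [Finset.card_erase_of_mem hp]; omega)
    obtain ⟨hrp, hr⟩ := Finset.mem_erase.mp hr
    have hpp : p.Prime := Nat.prime_of_mem_primeFactors hp
    have hrr : r.Prime := Nat.prime_of_mem_primeFactors hr
    obtain ⟨hDd, hadm₁, hdisj, hpf⟩ :=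
      hadm.erase_two_primes hpp hrr (Ne.symm hrp) (Nat.dvd_of_mem_primeFactors hp)
        (Nat.dvd_of_mem_primeFactors hr)
    set d := D / (p * r) with hd
    have hcard : D.primeFactors.card = d.primeFactors.card + 2 := by
      rw [hpf, Finset.card_union_of_disjoint hdisj, Finset.card_pair (Ne.symm hrp)]
    -- the curve `X₀^d(prM)` and a datum realising `δ_{d,prM}`; the class passes to `prM`
    obtain ⟨X₁⟩ := hX hadm₁
    obtain ⟨W₁', hW₁', P₁, hP₁min⟩ :=
      ShimuraParametrizationData.exists_isMinimalFor_of_nonempty (hP hadm₁ X₁ W hWN)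
    -- induction hypothesis at level `(d, prM)` and the bounded two-prime step
    obtain ⟨a₁, b₁, ha₁, hb₁, hb₁d, h₁⟩ :=
      ih hadm₁ X₁ (rtClass_mul hpp hrr hadm.pos_right hcl) W₁' P₁ hP₁min (by omega)
    obtain ⟨a₂, b₂, ha₂, hb₂, hb₂d, h₂⟩ :=
      hstep hpp hrr (Ne.symm hrp) hDd hadm X₁ X W hWN hcl W₁' P₁ hP₁min W' P hPmin
    refine ⟨a₁ * a₂, b₁ * b₂, Nat.mul_pos ha₁ ha₂, Nat.mul_pos hb₁ hb₂, ?_, ?_⟩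
    · rw [hcard, pow_add]
      exact mul_dvd_mul hb₁d (hb₂d.trans (dvd_pow_self κ₀ two_ne_zero))
    · rw [hpf, Finset.prod_union hdisj, Finset.prod_pair (Ne.symm hrp)]
      set V := ∏ q ∈ d.primeFactors, (W.minimalDiscriminantNorm ℤ).factorization q
      set vp := (W.minimalDiscriminantNorm ℤ).factorization p
      set vr := (W.minimalDiscriminantNorm ℤ).factorization r
      calc D₁.modularDegree * (b₁ * b₂) = D₁.modularDegree * b₁ * b₂ := by ring
        _ = a₁ * P₁.deg * V * b₂ := by rw [h₁]
        _ = a₁ * V * (P₁.deg * b₂) := by ring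
        _ = a₁ * V * (a₂ * P.deg * (vp * vr)) := by rw [h₂]
        _ = a₁ * a₂ * P.deg * (V * (vp * vr)) := by ring

/-! ### Conversely: the fact gives back its `D = 1` instance `h0` -/

/-- **The fact implies its `D = 1` input** (so the hypothesis `h0` of
`PastenShimura2024_thm_6_1_b_of_eqSequentially` asks for nothing beyond the fact): in the class
(b.1)/(b.2) relative to `M = N`, at the admissible factorisation `N = 1 · N` the fact gives
`δ_{1,N} · b = a · deg P` with `b ∣ κ⁰ = 1`, i.e. `deg P ∣ δ_{1,N}` for every class-minimal Shimura
datum `P` on a curve `X : ShimuraCurveData 1 N` (Pasten: `J₀^1(N) = J₀(N)`, §2 p. 12, so both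
numbers are `δ_{1,N}`). [cite: PastenShimura2024, Thm. 6.1 (b) p. 20 (case D = 1) with §2 p. 12] -/
theorem deg_dvd_of_PastenShimura2024_thm_6_1_b (h : PastenShimura2024_thm_6_1_b) {N : ℕ}
    [NeZero N] (X : ShimuraCurveData 1 N) (W : WeierstrassCurve ℚ) [W.IsElliptic]
    [W.IsGloballyMinimal] (hWN : W.conductorNorm ℤ = N)
    (hcl : (W.IsSemistable ℤ ∧ ¬ N.Prime) ∨
      (IsFreyHellegouarch W ∧ 2 ≤ (N.primeFactors.erase 2).card))
    (W₁ : WeierstrassCurve ℚ) [W₁.IsElliptic] (D₁ : ModularParametrizationData W₁ N)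
    (hf : IsNewformOf W D₁.f)
    (hmin : ∀ (W₂ : WeierstrassCurve ℚ) [W₂.IsElliptic] (D₂ : ModularParametrizationData W₂ N),
      D₂.f = D₁.f → D₁.modularDegree ≤ D₂.modularDegree)
    (W' : WeierstrassCurve ℚ) [W'.IsElliptic] (P : ShimuraParametrizationData X W')
    (hP : P.IsMinimalFor W) : P.deg ∣ D₁.modularDegree := by
  obtain ⟨κ, -, -, h⟩ := h
  obtain ⟨a, b, -, -, hb, hab⟩ :=
    h (isAdmissibleFactorization_one (NeZero.pos N)) X W hWN hcl W₁ D₁ hf hmin W' P hP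
  have hb1 : b = 1 := Nat.dvd_one.mp (by simpa using hb)
  subst hb1
  exact ⟨a, by simpa [mul_comm] using hab⟩

/-! ### The bounded two-prime step from Prop. 6.13, Lemma 6.14, Thm. 6.17 and Lemma 6.8 -/

/-- **(EqSequentially) for part (b) — the two-prime step with bounded denominator, from
Prop. 6.13 with Lemma 6.14 and Thm. 6.17, and Lemma 6.8** (§6.9 p. 25: "Here one also uses
Lemma 6.14 on the factors `i_p(d,prm)²` … the cokernel factors `j_r(dpr,m)²` are controlled by
Theorem 6.17"). Inputs, as explicit hypotheses because they are not declarations of the tree: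

* (`h613b`) **Prop. 6.13 = Ribet–Takahashi 1997, Thm. 2, with the bounds of Lemma 6.14 and
  Thm. 6.17 attached** (p. 23: "`δ_{d,prM}/δ_{dpr,M} = c_p(A_{d,prM}) · c_r(A_{dpr,M}) /
  (i_p(d,prM)² · j_r(dpr,M)²)`"; Lemma 6.14: `i_p(d,prM) ∣ κ_S` for `N` squarefree away from `S`,
  `p ∥ prM`; Thm. 6.17: `j_r(dpr,M) ∣ κ` for `r ∣ dpr` under (i)/(ii) at the factorisation
  `(dpr) · M`), in the tree's idiom: `A_{d,prM}`, `A_{D,M}` are the curves `W₁'`, `W₂'` of data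
  realising `δ_{d,prM}`, `δ_{D,M}` (`IsMinimalFor`), `c_p(A) = v_p` of the minimal discriminant,
  and — the tree having no component groups of Néron models — `i = i_p(d,prM)`, `j = j_r(D,M)` are
  existential positive integers carrying their bounds `i ∣ κ₁`, `j ∣ κ₂` (`κ₁ = κ_∅` resp. `κ_{2}`
  of Lemma 6.14, `κ₂ = κ` of Thm. 6.17), for `E` in class (b.1)/(b.2) relative to `M` (which makes
  `N` squarefree away from `∅` resp. `{2}`);
* (`h68`) **Lemma 6.8**, verbatim the hypothesis of the sibling's
  `eqSequentially_of_prop_6_13_of_lemma_6_8`: `W ∼ W'`, `p ∥ N_W` ⇒ `c_p(W') · b = a · c_p(W)`,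
  `1 ≤ a, b ≤ 163`.

Proof (as printed): `δ_{d,prM} i² j² = δ_{D,M} c_p(A₁) c_r(A₂)`, `c_p(A₁) b₁ = a₁ c_p(E)`,
`c_r(A₂) b₂ = a₂ c_r(E)` give `δ_{d,prM} · (i² j² b₁ b₂) = (a₁a₂) · δ_{D,M} · c_p(E) c_r(E)`, and
`i² j² b₁ b₂ ∣ κ₁² κ₂² (163!)²` (`b₁, b₂ ≤ 163` divide `163!`); `p, r ∣ D` divide `N` exactly once
(`IsAdmissibleFactorization.dvd_and_not_sq_dvd`). The conclusion is literally the hypothesis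
`hstep` of `PastenShimura2024_thm_6_1_b_of_eqSequentially` with `κ₀ = κ₁² κ₂² (163!)²`.
[cite: PastenShimura2024, §6.9 p. 25 ((EqSequentially), item (b)), Prop. 6.13 and Lemma 6.14 p. 23, Thm. 6.17 p. 24, Lemma 6.8 p. 22] -/
theorem eqSequentially_b_of_prop_6_13_bounded_of_lemma_6_8 {κ₁ κ₂ : ℕ}
    (h613b : ∀ {N D M d p r : ℕ}, p.Prime → r.Prime → p ≠ r → D = d * (p * r) →
      IsAdmissibleFactorization N D M →
      ∀ (X₁ : ShimuraCurveData d (p * r * M)) (X₂ : ShimuraCurveData D M)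
        (W : WeierstrassCurve ℚ) [W.IsElliptic] [W.IsGloballyMinimal], W.conductorNorm ℤ = N →
        (W.IsSemistable ℤ ∧ ¬ M.Prime) ∨
          (IsFreyHellegouarch W ∧ 2 ≤ (M.primeFactors.erase 2).card) →
      ∀ (W₁' : WeierstrassCurve ℚ) [W₁'.IsElliptic] (P₁ : ShimuraParametrizationData X₁ W₁'),
        P₁.IsMinimalFor W →
      ∀ (W₂' : WeierstrassCurve ℚ) [W₂'.IsElliptic] (P₂ : ShimuraParametrizationData X₂ W₂'),
        P₂.IsMinimalFor W →
        ∃ i j : ℕ, 0 < i ∧ 0 < j ∧ i ∣ κ₁ ∧ j ∣ κ₂ ∧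
          P₁.deg * (i ^ 2 * j ^ 2) = P₂.deg *
            ((W₁'.minimalDiscriminantNorm ℤ).factorization p *
              (W₂'.minimalDiscriminantNorm ℤ).factorization r))
    (h68 : ∀ (W W' : WeierstrassCurve ℚ) [W.IsElliptic] [W'.IsElliptic], W.IsIsogenous W' →
      ∀ p : ℕ, p.Prime → p ∣ W.conductorNorm ℤ → ¬ p ^ 2 ∣ W.conductorNorm ℤ →
        ∃ a b : ℕ, 0 < a ∧ a ≤ 163 ∧ 0 < b ∧ b ≤ 163 ∧
          (W'.minimalDiscriminantNorm ℤ).factorization p * b =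
            a * (W.minimalDiscriminantNorm ℤ).factorization p)
    {N D M d p r : ℕ} (hp : p.Prime) (hr : r.Prime) (hpr : p ≠ r) (hD : D = d * (p * r))
    (hadm : IsAdmissibleFactorization N D M)
    (X₁ : ShimuraCurveData d (p * r * M)) (X₂ : ShimuraCurveData D M)
    (W : WeierstrassCurve ℚ) [W.IsElliptic] [W.IsGloballyMinimal] (hWN : W.conductorNorm ℤ = N)
    (hcl : (W.IsSemistable ℤ ∧ ¬ M.Prime) ∨
      (IsFreyHellegouarch W ∧ 2 ≤ (M.primeFactors.erase 2).card))
    (W₁' : WeierstrassCurve ℚ) [W₁'.IsElliptic] (P₁ : ShimuraParametrizationData X₁ W₁')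
    (hP₁ : P₁.IsMinimalFor W)
    (W₂' : WeierstrassCurve ℚ) [W₂'.IsElliptic] (P₂ : ShimuraParametrizationData X₂ W₂')
    (hP₂ : P₂.IsMinimalFor W) :
    ∃ a b : ℕ, 0 < a ∧ 0 < b ∧ b ∣ κ₁ ^ 2 * κ₂ ^ 2 * (Nat.factorial 163) ^ 2 ∧
      P₁.deg * b = a * P₂.deg *
        ((W.minimalDiscriminantNorm ℤ).factorization p *
          (W.minimalDiscriminantNorm ℤ).factorization r) := by
  -- `p, r ∣ D` are multiplicative for `E`: `p ∥ N`, `r ∥ N`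
  have hpD : p ∣ D := ⟨d * r, by rw [hD]; ring⟩
  have hrD : r ∣ D := ⟨d * p, by rw [hD]; ring⟩
  obtain ⟨hpN, hp2N⟩ := hadm.dvd_and_not_sq_dvd hp hpD
  obtain ⟨hrN, hr2N⟩ := hadm.dvd_and_not_sq_dvd hr hrD
  rw [← hWN] at hpN hp2N hrN hr2N
  -- Prop. 6.13 with Lemma 6.14 / Thm. 6.17, and Lemma 6.8 (twice)
  obtain ⟨i, j, hi, hj, hiκ, hjκ, h13⟩ :=
    h613b hp hr hpr hD hadm X₁ X₂ W hWN hcl W₁' P₁ hP₁ W₂' P₂ hP₂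
  obtain ⟨a₁, b₁, ha₁, -, hb₁, hb₁le, h₁⟩ := h68 W W₁' hP₁.1 p hp hpN hp2N
  obtain ⟨a₂, b₂, ha₂, -, hb₂, hb₂le, h₂⟩ := h68 W W₂' hP₂.1 r hr hrN hr2N
  refine ⟨a₁ * a₂, i ^ 2 * j ^ 2 * (b₁ * b₂), Nat.mul_pos ha₁ ha₂,
    Nat.mul_pos (Nat.mul_pos (pow_pos hi 2) (pow_pos hj 2)) (Nat.mul_pos hb₁ hb₂), ?_, ?_⟩
  · refine mul_dvd_mul (mul_dvd_mul (pow_dvd_pow_of_dvd hiκ 2) (pow_dvd_pow_of_dvd hjκ 2)) ?_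
    rw [sq]
    exact mul_dvd_mul (Nat.dvd_factorial hb₁ hb₁le) (Nat.dvd_factorial hb₂ hb₂le)
  · set c₁ := (W₁'.minimalDiscriminantNorm ℤ).factorization p
    set c₂ := (W₂'.minimalDiscriminantNorm ℤ).factorization r
    set vp := (W.minimalDiscriminantNorm ℤ).factorization p
    set vr := (W.minimalDiscriminantNorm ℤ).factorization r
    calc P₁.deg * (i ^ 2 * j ^ 2 * (b₁ * b₂)) = P₁.deg * (i ^ 2 * j ^ 2) * (b₁ * b₂) := by ring
      _ = P₂.deg * (c₁ * c₂) * (b₁ * b₂) := by rw [h13]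
      _ = P₂.deg * ((c₁ * b₁) * (c₂ * b₂)) := by ring
      _ = P₂.deg * ((a₁ * vp) * (a₂ * vr)) := by rw [h₁, h₂]
      _ = a₁ * a₂ * P₂.deg * (vp * vr) := by ring

/-- The constant `κ = κ₁² κ₂² (163!)²` is supported on primes `≤ 163` when `κ₁, κ₂` are
(Thm. 6.1 (b): "`κ ≥ 1` supported on primes `≤ 163`"). [cite: PastenShimura2024, Thm. 6.1 (b) p. 20] -/
theorem primeFactors_le_of_kappa {κ₁ κ₂ : ℕ} (hκ₁ : 1 ≤ κ₁) (hκ₂ : 1 ≤ κ₂)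
    (hκ₁' : ∀ p ∈ κ₁.primeFactors, p ≤ 163) (hκ₂' : ∀ p ∈ κ₂.primeFactors, p ≤ 163) :
    ∀ p ∈ (κ₁ ^ 2 * κ₂ ^ 2 * (Nat.factorial 163) ^ 2).primeFactors, p ≤ 163 := by
  intro p hp
  have hp' := Nat.prime_of_mem_primeFactors hp
  -- a prime of the product divides `κ₁`, `κ₂` or `163!` (no numeral is unfolded)
  rcases (Nat.Prime.dvd_mul hp').mp (Nat.dvd_of_mem_primeFactors hp) with h | h
  · rcases (Nat.Prime.dvd_mul hp').mp h with h | h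
    · exact hκ₁' p (Nat.mem_primeFactors.mpr ⟨hp', hp'.dvd_of_dvd_pow h, by omega⟩)
    · exact hκ₂' p (Nat.mem_primeFactors.mpr ⟨hp', hp'.dvd_of_dvd_pow h, by omega⟩)
  · exact (Nat.Prime.dvd_factorial hp').mp (hp'.dvd_of_dvd_pow h)

/-- **Pasten 2024, Thm. 6.1 (b) from Prop. 6.13 (with Lemma 6.14 and Thm. 6.17) and Lemma 6.8** —
the whole printed proof of part (b) (§6.9 p. 25) performed in the tree: the bounded two-prime step
from `h613b` (Ribet–Takahashi's identity with `i_p ∣ κ₁`, `j_r ∣ κ₂` in the class) and `h68`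
(Mazur–Kenku) (`eqSequentially_b_of_prop_6_13_bounded_of_lemma_6_8`), then the telescoping
(`PastenShimura2024_thm_6_1_b_of_eqSequentially`, with the `D = 1` bridge `h0` and the existence
facts `nonempty_shimuraCurveData`, `nonempty_shimuraParametrizationData`); the constant of the
fact is `κ = κ₁² κ₂² (163!)² ≥ 1`, supported on primes `≤ 163`. What remains open for
`PastenShimura2024_thm_6_1_b_holds` is exactly `h613b` (Prop. 6.13, Lemma 6.14, Thm. 6.17), `h68`
(Lemma 6.8) and `h0`.
[cite: PastenShimura2024, Thm. 6.1 (b) p. 20, proof §6.9 p. 25, Prop. 6.13 and Lemma 6.14 p. 23, Thm. 6.17 p. 24, Lemma 6.8 p. 22] -/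
theorem PastenShimura2024_thm_6_1_b_of_prop_6_13_bounded_of_lemma_6_8
    (hX : nonempty_shimuraCurveData) (hP : nonempty_shimuraParametrizationData)
    (h0 : ∀ {N : ℕ} [NeZero N] (X : ShimuraCurveData 1 N) (W : WeierstrassCurve ℚ) [W.IsElliptic]
      [W.IsGloballyMinimal], W.conductorNorm ℤ = N →
      (W.IsSemistable ℤ ∧ ¬ N.Prime) ∨
        (IsFreyHellegouarch W ∧ 2 ≤ (N.primeFactors.erase 2).card) →
      ∀ (W₁ : WeierstrassCurve ℚ) [W₁.IsElliptic] (D₁ : ModularParametrizationData W₁ N),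
        IsNewformOf W D₁.f →
        (∀ (W₂ : WeierstrassCurve ℚ) [W₂.IsElliptic] (D₂ : ModularParametrizationData W₂ N),
            D₂.f = D₁.f → D₁.modularDegree ≤ D₂.modularDegree) →
      ∀ (W' : WeierstrassCurve ℚ) [W'.IsElliptic] (P : ShimuraParametrizationData X W'),
        P.IsMinimalFor W → P.deg ∣ D₁.modularDegree)
    {κ₁ κ₂ : ℕ} (hκ₁ : 1 ≤ κ₁) (hκ₂ : 1 ≤ κ₂) (hκ₁' : ∀ p ∈ κ₁.primeFactors, p ≤ 163)
    (hκ₂' : ∀ p ∈ κ₂.primeFactors, p ≤ 163)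
    (h613b : ∀ {N D M d p r : ℕ}, p.Prime → r.Prime → p ≠ r → D = d * (p * r) →
      IsAdmissibleFactorization N D M →
      ∀ (X₁ : ShimuraCurveData d (p * r * M)) (X₂ : ShimuraCurveData D M)
        (W : WeierstrassCurve ℚ) [W.IsElliptic] [W.IsGloballyMinimal], W.conductorNorm ℤ = N →
        (W.IsSemistable ℤ ∧ ¬ M.Prime) ∨
          (IsFreyHellegouarch W ∧ 2 ≤ (M.primeFactors.erase 2).card) →
      ∀ (W₁' : WeierstrassCurve ℚ) [W₁'.IsElliptic] (P₁ : ShimuraParametrizationData X₁ W₁'),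
        P₁.IsMinimalFor W →
      ∀ (W₂' : WeierstrassCurve ℚ) [W₂'.IsElliptic] (P₂ : ShimuraParametrizationData X₂ W₂'),
        P₂.IsMinimalFor W →
        ∃ i j : ℕ, 0 < i ∧ 0 < j ∧ i ∣ κ₁ ∧ j ∣ κ₂ ∧
          P₁.deg * (i ^ 2 * j ^ 2) = P₂.deg *
            ((W₁'.minimalDiscriminantNorm ℤ).factorization p *
              (W₂'.minimalDiscriminantNorm ℤ).factorization r))
    (h68 : ∀ (W W' : WeierstrassCurve ℚ) [W.IsElliptic] [W'.IsElliptic], W.IsIsogenous W' →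
      ∀ p : ℕ, p.Prime → p ∣ W.conductorNorm ℤ → ¬ p ^ 2 ∣ W.conductorNorm ℤ →
        ∃ a b : ℕ, 0 < a ∧ a ≤ 163 ∧ 0 < b ∧ b ≤ 163 ∧
          (W'.minimalDiscriminantNorm ℤ).factorization p * b =
            a * (W.minimalDiscriminantNorm ℤ).factorization p) :
    PastenShimura2024_thm_6_1_b :=
  -- the constant of the fact: `κ = κ₁² κ₂² (163!)²`
  PastenShimura2024_thm_6_1_b_of_eqSequentially hX hP
    (κ₀ := κ₁ ^ 2 * κ₂ ^ 2 * (Nat.factorial 163) ^ 2)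
    (Nat.one_le_iff_ne_zero.mpr (mul_ne_zero (mul_ne_zero (pow_ne_zero 2 (by omega))
      (pow_ne_zero 2 (by omega))) (pow_ne_zero 2 (Nat.factorial_pos 163).ne')))
    (primeFactors_le_of_kappa hκ₁ hκ₂ hκ₁' hκ₂') h0
    fun hp hr hpr hD hadm X₁ X₂ W _ _ hWN hcl W₁' _ P₁ hP₁ W₂' _ P₂ hP₂ =>
      eqSequentially_b_of_prop_6_13_bounded_of_lemma_6_8 h613b h68 hp hr hpr hD hadm X₁ X₂ W hWN
        hcl W₁' P₁ hP₁ W₂' P₂ hP₂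

end Literature.NumberTheory.Automorphic

end
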